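import Literature.NumberTheory.Automorphic.Liu2021.AppendixC.Thm415Pinned
import Literature.NumberTheory.Automorphic.Liu2021.Def45CMCharacter
import Literature.NumberTheory.Automorphic.Liu2021.Def45RMuFormSupply
import Literature.NumberTheory.GaloisRepresentations.HeckeCharacterWeakApproximation
import Literature.NumberTheory.GaloisRepresentations.IntegralGaloisActionProofs
import Literature.AlgebraicGeometry.Motives.GoodReductionProofs
import Literature.AlgebraicGeometry.Motives.AbelianVarietyGoodReductionCofinite
import Literature.AlgebraicGeometry.Motives.AbelianVarietyProjectiveChart
import Mathlib.LinearAlgebra.Dual.BaseChange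
import HarnessLib

/-!
# [Liu 2021, Thm 4.18, proof l. 2258–2266] the labels `μ′ ≠ μ` contribute nothing: GALOIS SEPARATION OF THE LABELS

Topic `NumberTheory/Automorphic/Liu2021/AppendixC`; namespace `Literature.NumberTheory.Automorphic.Liu2021.AppendixC`.
Cell `hodgecm-mathlib` (D-0151), fan A, rung A-III, skeleton `Lines/a3-liu418.lean` v3 (sha16 1b96ade3f8b6b529), registered stub
`stub_galoisLabelSeparation : StubGaloisLabelSeparation` (KEY `a3-galois-label-separation`).  THEOREMS ONLY (no definition, no named
fact; net Literature debt 0).  HC_CM is proved only modulo the 7 printed citations (`hDel`, `h21`, `hLiu418`, `h411`, `h413`, `hD3`,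
`hD1''`) until rung 0 closes; this file discharges none of them — it proves the GENERIC form of the stub from [Thm 4.15] (taken BY NAME
as the hypothesis `h415 : ∀ μ …, Thm415Pinned …`, B-typ04's row III-9′) and Casselman's theorem `h21` (the headline binder, which supplies
a CM datum of every label, [Liu2021] Prop. 4.6 (1)).

## The printed text (Y. Liu, Camb. J. Math. 9 (2021) = arXiv:2102.11518, `FJcycle.tex`, proof of Thm 4.18, l. 2258–2268)

«However, by Definition 4.5 (2), the action of `Gal(ℂ/τ'(E))` on the line `ℚ_ℓ^{ac}·α` spanned by `α` is given by the automorphic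
character `ι_ℓ ∘ μ^{alg} ∘ (τ')⁻¹ : τ'(E)^× \ 𝔸_{τ'(E)}^× → (ℚ_ℓ^{ac})^×`.  When `n ≥ 3` […], by Proposition 4.13 […] and Theorem 4.15
[…], we have an isomorphism `Hom_{ℚ_ℓ^{ac}[Gal(ℂ/τ'(E))]}(ℚ_ℓ^{ac}·α, H¹_ét(A_μ ⊗_{E,τ'} ℂ, ℚ_ℓ^{ac})) ≃ ⊕_ε ⊕_χ ω(μ,ε,χ) ⊗_{ℂ,ι_ℓ} ℚ_ℓ^{ac}`
of `ℚ_ℓ^{ac}[𝔾(𝔸_F^∞)]`-modules».  The sum is over the labels with FIRST component `μ`: the `ω(μ′,ε,χ)`-isotypic part of `H¹_ét(A_∞)`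
for `μ′ ≠ μ` carries, by [Thm 4.15] at `μ′`, the Galois character `ι_ℓ ∘ μ′^{alg}`, the line `ℚ_ℓ^{ac}·α` carries `ι_ℓ ∘ μ^{alg}` ([Def 4.5 (2)]
for `A_μ`), and `μ′^{alg} ≠ μ^{alg}` as `ℓ`-adic Galois characters because an (algebraic) Hecke character is determined by its values at
the uniformisers of almost all places (class field theory / Chebotarev in its weakest form: the Frobenius elements at the unramified good
places see `χ(ϖ_v)`).  This is exactly the skeleton's predicate `GaloisLabelSeparation` (see `Lines/a3-liu418.lean` :247–:260).

## What is proved here (all over EXISTING carriers; axioms `propext`/`Classical.choice`/`Quot.sound`)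

§1 `exists_ne_zero_mem_cmEigenline` — for a pair `(B, i : M → End⁰(B))` with `[M : ℚ] = 2 dim B` (a CM structure, Def. 4.5 (2)
   READING I1-R3) and any `ι : ℂ ≃+* ℚ_ℓ^{ac}`, the eigenline `cmEigenline ℓ B M i ι` («`ℚ_ℓ^{ac}·α`», `Thm415Pinned.lean`) is NON-ZERO.
   Proof: Serre–Tate 1968 §4 Thm 5 (i) — `V_ℓ B` is free of rank one over `F_ℓ = ℚ_ℓ ⊗_ℚ M` (tree `exists_bijective_cmTateAction`,
   PROVED) — so `V_ℓ B ≅ F_ℓ`; the character `ψ = ι|_M` extends to `ψ_ℓ : F_ℓ → ℚ_ℓ^{ac}`, `c ⊗ m ↦ c·ι(m)`, an `M`-eigenfunctional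
   `g : V_ℓ B → ℚ_ℓ^{ac}` with `g(i(m)·v) = ι(m) g(v)`, `g ≠ 0`; and `ℚ_ℓ^{ac} ⊗_{ℚ_ℓ} (V_ℓ B)^∨ ≅ Hom_{ℚ_ℓ^{ac}}(ℚ_ℓ^{ac} ⊗ V_ℓ B, ℚ_ℓ^{ac})`
   (Mathlib `IsBaseChange.toDualBaseChange`) carries `g` to a non-zero element of the eigenline.
§2 `galoisH1Bar_eq_smul_of_isCMCharacterMuAlg` — [Def 4.5 (2), second bullet] in its FROBENIUS FORM (`Def45.IsCMCharacterMuAlg`, implied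
   by the print-equivalent `IsCMCharacterMuAlgHecke` of `Carriers.ofPolDR`): at a good place `v ∤ ℓ` where `μ^{alg}` is unramified, every
   arithmetic Frobenius `σ` at a prime above `v` acts on the eigenline of `(A_μ, i_μ)` by the scalar `ι(μ^{alg}(ϖ_v))⁻¹` (inverse because
   `H¹ = V_ℓ^∨` carries the contragredient action; `ρ_{V_ℓ}(σ) = V_ℓ(i_μ(μ^{alg}(ϖ_v)))` from `M·ρ_ℓ(σ) = T_ℓ(f)`).
§3 `galoisLabelSeparation_of_thm415Pinned` — the GENERIC separation statement for any §4.2 datum `C` with `3 ≤ n`, any uniform family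
   `U`, any Hecke datum `X`, any `ι`, a CM field `E` Galois over `ℚ` and the Def-4.5 carriers `Carriers.ofPolDR μ (PolDR σ₁ hμ (RMuForm σ₁ hμ))`
   of the cell: GIVEN `h21` and `h415 : ∀ μ hμ hw obj, Thm415Pinned C U ℓ X ι μ hμ (AμOne … obj) (iOne … obj)`, for `μ′ ≠ ν`, `ε` `μ′`-admissible
   and a non-zero `f ∈ Hom_{ℚ_ℓ^{ac}[𝔾]}(ι∘ω(μ′,ε,χ), ℚ_ℓ^{ac} ⊗ H¹_ét(A_∞))`, some `σ ∈ Γ_E` acting by `c` on a non-zero vector of the `A_ν`-line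
   does NOT act by `c` on `f`.  Proof as above: else for almost all `v` (good for `A_ν`, `A_{μ′}`; unramified for `ν^{alg}`, `μ′^{alg}`; `v ∤ ℓ`
   — `exists_finite_hasGoodReductionOutside_holds`, `finite_ramifiedPlaces_holds`, `Ideal.finite_factors`) the Frobenius at `v`
   (`exists_isArithFrobAt_of_mem_primesAbove_holds`) gives `ι(ν^{alg}(ϖ_v))⁻¹ · f(w₀) = ι(μ′^{alg}(ϖ_v))⁻¹ · f(w₀)` with `f(w₀) ≠ 0`, hence
   `ν^{alg}(ϖ_v) = μ′^{alg}(ϖ_v)`, so `ν^{alg} = μ′^{alg}` (`HeckeCharacter.ext_of_eventually_valueAtUniformizer_eq`) and `ν = μ′`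
   (`muAlg` = `toHeckeCharacter · ‖·‖^{-1/2}`, `toHeckeCharacter_injective`) — contradiction.
§4 `galoisLabelSeparation_objOne_of_thm415Pinned` — the same with the CM datum of `μ′` SUPPLIED from `h21`
   (`Def45.nonempty_cmDatum_polDR_rMuForm_of_casselman`), i.e. the exact shape the skeleton's face consumes.

ORIENTATION: none chosen here (`C`, `U`, `X` are the consumer's); the sign S1 of the cell's A3-ORIENTATION §3 lives in the consumer's
instantiation of `h415`.  Nothing of [Liu2021] is asserted: [Thm 4.15] and [Shimura 21.4] are HYPOTHESES of every theorem.

## References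
* [Liu2021] Y. Liu, *Fourier–Jacobi cycles and arithmetic relative trace formula*, Camb. J. Math. 9 (2021) = arXiv:2102.11518 — Thm 4.18
  proof (FJcycle.tex l. 2247–2268), Thm 4.15 (l. 2177–2182), Def. 4.5 (2) (l. 1952), Prop. 4.6 (1) (l. 1969).
* [SerreTate1968] J.-P. Serre, J. Tate, *Good reduction of abelian varieties*, Ann. of Math. 88 (1968) — §4 Thm 5 (i), §7 Thm 10–11.
* [CasselsFrohlichANT1967] Ch. VII §4 Prop. 4.1 (a Grössencharakter is determined by its values off a finite set).
* [Shimura1998] G. Shimura, *Abelian Varieties with Complex Multiplication and Modular Functions*, §19.10–19.11, §21.4 Thm 21.4.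
-/

set_option autoImplicit false

noncomputable section

open CategoryTheory NumberField IsDedekindDomain
open scoped TensorProduct NumberField

namespace Literature.NumberTheory.Automorphic.Liu2021.AppendixC

open Literature.AlgebraicGeometry.Motives (AbelianVariety HasGoodReductionAt SchemeOver)
open Literature.AlgebraicGeometry.Motives.AbelianVariety (rationalTateAction rationalTateModuleMap rationalTateAction_of_eq_algebraMap_mul_of
  rationalTateRep_apply endAlgebra.exists_eq_algebraMap_mul_of module_finite_tateModule_of_cast_ne_zero isSmoothProjective_holds)
open Literature.AlgebraicGeometry.ComplexMultiplication (cmTateAction cmTateAction_one_tmul exists_bijective_cmTateAction)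
open Literature.NumberTheory.GaloisRepresentations
open Literature.NumberTheory.ComplexMultiplication (shimura1998_thm21_4_casselman)
open Literature.AlgebraicGeometry.Liu2021 (IsAdmissibleElement)

/-! ## §1  The eigenline `ℚ_ℓ^{ac}·α` of a CM pair is non-zero (Serre–Tate §4 Thm 5 (i)) -/

section CMLine

variable {K : Type} [Field K] [NumberField K] (ℓ : ℕ) [Fact ℓ.Prime]

/-- Bookkeeping for the dual transfer: for `T ∈ End(V)`, `x ∈ L ⊗ V^∨` and `v ∈ V`, the iso
`Φ : L ⊗_{ℚ_ℓ} V^∨ ≃ Hom_L(L ⊗ V, L)` (Mathlib `IsBaseChange.toDualBaseChange`) satisfies `Φ((1 ⊗ ᵗT) x)(1 ⊗ v) = Φ(x)(1 ⊗ T v)`.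
[folklore] -/
private theorem toDualBaseChange_dualMap_baseChange {V : Type} [AddCommGroup V] [Module ℚ_[ℓ] V] [Module.Free ℚ_[ℓ] V]
    [Module.Finite ℚ_[ℓ] V] (T : V →ₗ[ℚ_[ℓ]] V)
    (x : AlgebraicClosure ℚ_[ℓ] ⊗[ℚ_[ℓ]] Module.Dual ℚ_[ℓ] V) (v : V) :
    (TensorProduct.isBaseChange ℚ_[ℓ] V (AlgebraicClosure ℚ_[ℓ])).toDualBaseChange
        ((T.dualMap).baseChange (AlgebraicClosure ℚ_[ℓ]) x) ((TensorProduct.mk ℚ_[ℓ] (AlgebraicClosure ℚ_[ℓ]) V 1) v) =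
      (TensorProduct.isBaseChange ℚ_[ℓ] V (AlgebraicClosure ℚ_[ℓ])).toDualBaseChange x
        ((TensorProduct.mk ℚ_[ℓ] (AlgebraicClosure ℚ_[ℓ]) V 1) (T v)) := by
  induction x using TensorProduct.induction_on with
  | zero => simp only [map_zero, LinearMap.zero_apply]
  | tmul a φ =>
    rw [LinearMap.baseChange_tmul, IsBaseChange.toDualBaseChange_tmul, IsBaseChange.toDualBaseChange_tmul,
      LinearMap.dualMap_apply]
  | add x y hx hy => simp only [map_add, LinearMap.add_apply, hx, hy]

/-- **The line `ℚ_ℓ^{ac}·α` is non-zero.**  For an abelian variety `B` over a number field `K` with an action `i : M → End⁰(B)` of a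
subfield `M ⊆ ℂ` of degree `[M : ℚ] = 2 dim B` («`i_μ` is a CM structure», [Liu2021] Def. 4.5 (2)) and `ι : ℂ ≃+* ℚ_ℓ^{ac}`, the
`ℚ_ℓ^{ac}`-subspace of `ℚ_ℓ^{ac} ⊗_{ℚ_ℓ} H¹_ét(B, ℚ_ℓ)` «over which `M` acts via the inclusion `M ↪ ℂ`» read through `ι` (`cmEigenline`)
contains a non-zero vector — print: «It is clear that the maximal subspace […] has dimension 1. We choose a basis `α` of this subspace»
(Thm 4.18 proof, l. 2250).  Proof: Serre–Tate §4 Thm 5 (i) (`exists_bijective_cmTateAction`: `V_ℓ B ≅ ℚ_ℓ ⊗_ℚ M` as `ℚ_ℓ ⊗_ℚ M`-modules),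
the character `c ⊗ m ↦ c·ι(m)` of `ℚ_ℓ ⊗_ℚ M`, and the dual transfer `ℚ_ℓ^{ac} ⊗ V^∨ ≅ Hom(ℚ_ℓ^{ac} ⊗ V, ℚ_ℓ^{ac})`.
[cite: Liu2021, Thm 4.18 proof (FJcycle.tex l. 2250)] [cite: SerreTate1968, §4 Thm. 5 (i)] -/
theorem exists_ne_zero_mem_cmEigenline (B : AbelianVariety K) (M : Subfield ℂ) [Module.Finite ℚ M]
    (i : M →+* B.endAlgebra) (hM : Module.finrank ℚ M = 2 * B.dim) (ι : ℂ ≃+* AlgebraicClosure ℚ_[ℓ]) :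
    ∃ x ∈ cmEigenline ℓ B M i ι, x ≠ 0 := by
  classical
  have hℓ : (ℓ : K) ≠ 0 := Nat.cast_ne_zero.mpr (Fact.out : ℓ.Prime).ne_zero
  haveI := module_finite_tateModule_of_cast_ne_zero B ℓ hℓ
  haveI : Module.Finite ℚ_[ℓ] (B.rationalTateModule ℓ) :=
    inferInstanceAs (Module.Finite ℚ_[ℓ] (ℚ_[ℓ] ⊗[ℤ_[ℓ]] B.tateModule ℓ))
  -- Serre–Tate §4 Thm 5 (i): a cyclic vector `v₀` with `s ↦ θ(s) v₀` a bijection `F_ℓ → V_ℓ B`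
  obtain ⟨v₀, hv₀⟩ := exists_bijective_cmTateAction (A := B) (ℓ := ℓ) hℓ i hM
  let θ := cmTateAction B ℓ i
  let eLin : (ℚ_[ℓ] ⊗[ℚ] M) →ₗ[ℚ_[ℓ]] B.rationalTateModule ℓ := (LinearMap.applyₗ v₀).comp θ.toLinearMap
  have heLin : ∀ s, eLin s = θ s v₀ := fun s => rfl
  let e : (ℚ_[ℓ] ⊗[ℚ] M) ≃ₗ[ℚ_[ℓ]] B.rationalTateModule ℓ := LinearEquiv.ofBijective eLin hv₀
  have he : ∀ s, e s = θ s v₀ := fun s => rfl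
  -- the character `ψ = ι|_M` of `M`, extended `ℚ_ℓ`-linearly to `F_ℓ = ℚ_ℓ ⊗_ℚ M`
  let jM : M →ₐ[ℚ] AlgebraicClosure ℚ_[ℓ] := ((ι : ℂ →+* AlgebraicClosure ℚ_[ℓ]).comp M.subtype).toRatAlgHom
  let ψ : (ℚ_[ℓ] ⊗[ℚ] M) →ₐ[ℚ_[ℓ]] AlgebraicClosure ℚ_[ℓ] :=
    Algebra.TensorProduct.lift (Algebra.ofId ℚ_[ℓ] (AlgebraicClosure ℚ_[ℓ])) jM (fun _ _ => Commute.all _ _)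
  have hψ : ∀ (c : ℚ_[ℓ]) (m : M), ψ (c ⊗ₜ[ℚ] m) = c • ι (m : ℂ) := by
    intro c m
    rw [Algebra.TensorProduct.lift_tmul, Algebra.ofId_apply, ← Algebra.smul_def]
    rfl
  -- the `M`-eigenfunctional `g = ψ ∘ e⁻¹ : V_ℓ B → ℚ_ℓ^{ac}`
  let g : B.rationalTateModule ℓ →ₗ[ℚ_[ℓ]] AlgebraicClosure ℚ_[ℓ] := ψ.toLinearMap.comp e.symm.toLinearMap
  have hg_apply : ∀ v, g v = ψ (e.symm v) := fun v => rfl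
  have hg : ∀ (m : M) (v : B.rationalTateModule ℓ), g (rationalTateAction B ℓ (i m) v) = ι (m : ℂ) • g v := by
    intro m v
    obtain ⟨s, rfl⟩ := e.surjective v
    have h1 : rationalTateAction B ℓ (i m) (e s) = e ((1 : ℚ_[ℓ]) ⊗ₜ[ℚ] m * s) := by
      rw [he, he, map_mul, Module.End.mul_apply, cmTateAction_one_tmul]
    rw [h1, hg_apply, hg_apply, e.symm_apply_apply, e.symm_apply_apply, map_mul, hψ, one_smul, smul_eq_mul]
  have hg1 : g (e 1) = 1 := by rw [hg_apply, e.symm_apply_apply, map_one]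
  -- transfer to `ℚ_ℓ^{ac} ⊗ V^∨` along `Φ : L ⊗ V^∨ ≃ Hom_L(L ⊗ V, L)`
  set L := AlgebraicClosure ℚ_[ℓ] with hL
  have ibc := TensorProduct.isBaseChange ℚ_[ℓ] (B.rationalTateModule ℓ) L
  let Φ := ibc.toDualBaseChange
  let G : Module.Dual L (L ⊗[ℚ_[ℓ]] B.rationalTateModule ℓ) := g.liftBaseChange L
  refine ⟨Φ.symm G, ?_, ?_⟩
  · intro m
    apply Φ.injective
    refine ibc.algHom_ext _ _ fun v => ?_
    rw [toDualBaseChange_dualMap_baseChange, LinearEquiv.apply_symm_apply, map_smul, LinearMap.smul_apply,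
      LinearEquiv.apply_symm_apply, TensorProduct.mk_apply, TensorProduct.mk_apply, LinearMap.liftBaseChange_tmul,
      LinearMap.liftBaseChange_tmul, one_smul, one_smul, hg]
  · intro h0
    have hG : G = 0 := by
      have := congrArg Φ h0
      rwa [LinearEquiv.apply_symm_apply, map_zero] at this
    have h1 : G ((1 : L) ⊗ₜ[ℚ_[ℓ]] e 1) = 1 := by
      rw [LinearMap.liftBaseChange_tmul, one_smul, hg1]
    rw [hG, LinearMap.zero_apply] at h1
    exact zero_ne_one h1

end CMLine

/-! ## §2  [Def 4.5 (2)] in Frobenius form on the eigenline: `Frob_v` acts on `ℚ_ℓ^{ac}·α` by `ι(μ^{alg}(ϖ_v))⁻¹` -/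

section CMCharacter

variable {E : Type} [Field E] [NumberField E] {μ : IdeleClassGroup E →ₜ* Circle}
variable (ℓ : ℕ) [Fact ℓ.Prime]

/-- **The Frobenius eigenvalue on the line `ℚ_ℓ^{ac}·α`** (Thm 4.18 proof, l. 2263: «by Definition 4.5 (2), the action of
`Gal(ℂ/τ'(E))` on the line `ℚ_ℓ^{ac}·α` […] is given by the automorphic character `ι_ℓ ∘ μ^{alg} ∘ (τ')⁻¹`»).  For a pair `(B, i)`
satisfying [Def 4.5 (2), second bullet] in the FROBENIUS FORM `Def45.IsCMCharacterMuAlg μ B i` («Frobenius at `v` acts on `T_ℓ B` as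
`i(μ^{alg}(ϖ_v))`»), a finite place `v` of good reduction where `μ^{alg}` is unramified, `v ∤ ℓ`, a prime `𝔓 ∣ v` and an ARITHMETIC
Frobenius `σ` at `𝔓`: on every vector of `cmEigenline ℓ B M_μ i ι` the element `σ` acts (through the contragredient action `galoisH1Bar`
on `ℚ_ℓ^{ac} ⊗ H¹_ét(B) = ℚ_ℓ^{ac} ⊗ V_ℓ(B)^∨`) by the scalar `ι(μ^{alg}(ϖ_v))⁻¹`.
Proof: `M · ρ_ℓ(σ) = T_ℓ(f)` with `i(μ^{alg}(ϖ_v)) = M⁻¹(1 ⊗ f)` gives `ρ_{V_ℓ}(σ) = V_ℓ(i(π_v))`, `π_v = μ^{alg}(ϖ_v) ∈ M_μ`, hence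
`ρ_{V_ℓ}(σ⁻¹) = V_ℓ(i(π_v⁻¹))`, and `ᵗV_ℓ(i(π_v⁻¹))` acts on the eigenline by `ι(π_v⁻¹)`.
[cite: Liu2021, Def. 4.5 (2) (FJcycle.tex l. 1952) and Thm 4.18 proof (l. 2263)] [cite: SerreTate1968, §7 Thm. 10 (c), Thm. 11] -/
theorem galoisH1Bar_eq_smul_of_isCMCharacterMuAlg {B : AbelianVariety E}
    {i : IdeleClassGroup.muAlgValueField E μ →+* B.endAlgebra} (h : Def45.IsCMCharacterMuAlg μ B i)
    (ι : ℂ ≃+* AlgebraicClosure ℚ_[ℓ]) {v : HeightOneSpectrum (𝓞 E)}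
    (hv : ∃ (𝒜 : SchemeOver (HeightOneSpectrum.valuationSubringAtPrime E v)) (_ : GrpObj 𝒜),
      Literature.NumberTheory.DiophantineGeometry.IsAbelianSchemeModel B v 𝒜)
    (hur : (IdeleClassGroup.muAlg E μ).IsUnramifiedAt v) (hℓ : (ℓ : 𝓞 E) ∉ v.asIdeal)
    {𝔓 : Ideal (absIntegers (𝓞 E) E)} (h𝔓 : 𝔓 ∈ v.primesAbove) {σ : Field.absoluteGaloisGroup E}
    (hσ : IsArithFrobAt (𝓞 E) σ 𝔓)
    {x : AlgebraicClosure ℚ_[ℓ] ⊗[ℚ_[ℓ]] Module.Dual ℚ_[ℓ] (B.rationalTateModule ℓ)}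
    (hx : x ∈ cmEigenline ℓ B (IdeleClassGroup.muAlgValueField E μ) i ι) :
    galoisH1Bar ℓ B σ x = (ι ((IdeleClassGroup.muAlg E μ).valueAtUniformizer v))⁻¹ • x := by
  set π : IdeleClassGroup.muAlgValueField E μ := Def45.muAlgUniformizerValue μ v with hπdef
  -- the Frobenius element `π_v = μ^{alg}(ϖ_v)` is a unit of `M_μ`
  have hπ0 : π ≠ 0 := by
    intro h0
    have h1 : ((π : IdeleClassGroup.muAlgValueField E μ) : ℂ) = 0 := by rw [h0]; rfl
    rw [hπdef, Def45.coe_muAlgUniformizerValue] at h1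
    simp only [HeckeCharacter.valueAtUniformizer] at h1
    exact Units.ne_zero _ h1
  -- presentation `i(π_v) = M⁻¹ · (1 ⊗ f)` and the Frobenius identity `M · ρ_ℓ(σ) = T_ℓ(f)`
  obtain ⟨M, f, hM, hpres⟩ := endAlgebra.exists_eq_algebraMap_mul_of (i π)
  have hT := h v hv hur M f hM hpres ℓ hℓ 𝔓 h𝔓 σ hσ
  -- Step 1: `ρ_{V_ℓ}(σ) = V_ℓ(i(π_v))`
  have hM' : (M : ℚ_[ℓ]) ≠ 0 := Nat.cast_ne_zero.mpr hM
  have h1 : B.rationalTateRep ℓ σ = rationalTateAction B ℓ (i π) := by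
    rw [rationalTateAction_of_eq_algebraMap_mul_of B ℓ hpres]
    have h2 : (rationalTateModuleMap ℓ (f : B ⟶ B) : Module.End ℚ_[ℓ] (B.rationalTateModule ℓ)) =
        (M : ℚ_[ℓ]) • B.rationalTateRep ℓ σ := by
      rw [rationalTateRep_apply, rationalTateModuleMap, ← hT, LinearMap.baseChange_smul,
        Nat.cast_smul_eq_nsmul, Nat.cast_smul_eq_nsmul]
      rfl
    rw [h2, inv_smul_smul₀ hM']
  -- Step 2: `ρ_{V_ℓ}(σ⁻¹) = V_ℓ(i(π_v⁻¹))`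
  have h3 : B.rationalTateRep ℓ σ⁻¹ = rationalTateAction B ℓ (i π⁻¹) := by
    have hinv : rationalTateAction B ℓ (i π) * rationalTateAction B ℓ (i π⁻¹) = 1 := by
      rw [← map_mul, ← map_mul, mul_inv_cancel₀ hπ0, map_one, map_one]
    calc B.rationalTateRep ℓ σ⁻¹ = B.rationalTateRep ℓ σ⁻¹ * (rationalTateAction B ℓ (i π) * rationalTateAction B ℓ (i π⁻¹)) := by
          rw [hinv, mul_one]
      _ = (B.rationalTateRep ℓ σ⁻¹ * B.rationalTateRep ℓ σ) * rationalTateAction B ℓ (i π⁻¹) := by rw [h1, mul_assoc]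
      _ = rationalTateAction B ℓ (i π⁻¹) := by rw [← map_mul, inv_mul_cancel, map_one, one_mul]
  -- Step 3: on the eigenline `ᵗV_ℓ(i(π_v⁻¹))` is `ι(π_v⁻¹)`
  have h4 : galoisH1Bar ℓ B σ = ((rationalTateAction B ℓ (i π⁻¹)).dualMap).baseChange (AlgebraicClosure ℚ_[ℓ]) := by
    rw [galoisH1Bar, Representation.dual_apply, h3]
    rfl
  rw [h4, (mem_cmEigenline_iff ℓ B _ i ι x).1 hx π⁻¹, Subfield.coe_inv, map_inv₀, hπdef, Def45.coe_muAlgUniformizerValue]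

end CMCharacter

/-! ## §3  The separation of the labels (Thm 4.18 proof l. 2258–2266), generic over `(C, U, X, ι)` -/

section Helpers

variable {E : Type} [Field E] [NumberField E]

/-- Only finitely many finite places lie above `ℓ` (`Ideal.finite_factors`). [folklore] -/
private theorem finite_setOf_natCast_mem_asIdeal (ℓ : ℕ) [Fact ℓ.Prime] :
    {v : HeightOneSpectrum (𝓞 E) | (ℓ : 𝓞 E) ∈ v.asIdeal}.Finite := by
  have hI : (Ideal.span {(ℓ : 𝓞 E)} : Ideal (𝓞 E)) ≠ ⊥ := by
    rw [Ne, Ideal.span_singleton_eq_bot]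
    exact_mod_cast (Fact.out : ℓ.Prime).ne_zero
  exact (Ideal.finite_factors hI).subset fun v hv => Ideal.dvd_span_singleton.2 hv

/-- Abelian varieties over number fields have good reduction IN THE SENSE OF SERRE–TATE (an abelian-scheme model over `𝓞_{E,v}`)
at almost all places — spreading out the GROUP law (tree ★ `AbelianVariety.exists_finite_forall_exists_isAbelianSchemeModel`,
`AbelianVarietyGoodReductionCofinite`; edition E-ST). [cite: SerreTate1968, §1] [cite: Milne1986AbelianVarieties, §20 Rem. 20.9] -/
private theorem eventually_exists_isAbelianSchemeModel (B : AbelianVariety E) :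
    ∀ᶠ v : HeightOneSpectrum (𝓞 E) in Filter.cofinite,
      ∃ (𝒜 : SchemeOver (HeightOneSpectrum.valuationSubringAtPrime E v)) (_ : GrpObj 𝒜),
        Literature.NumberTheory.DiophantineGeometry.IsAbelianSchemeModel B v 𝒜 := by
  obtain ⟨S, hS, hgood⟩ :=
    Literature.AlgebraicGeometry.Motives.AbelianVariety.exists_finite_forall_exists_isAbelianSchemeModel B
  rw [Filter.eventually_cofinite]
  exact hS.subset fun v hv => by
    by_contra hvS
    exact hv (hgood v hvS)

variable [IsCMField E] [IsGalois ℚ E]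

/-- The chosen CM datum of an `ObjOne` over the cell's carrier `Carriers.ofPolDR μ (PolDR σ₁ hμ (RMuForm σ₁ hμ))` (the skeleton's `CarN`) satisfies [Def 4.5 (2), bullet 2] in Frobenius form (the print-equivalent
`IsCMCharacterMuAlgHecke` of `Carriers.ofPolDR`, projected by `IsCMCharacterMuAlgHecke.isCMCharacterMuAlg`).
[cite: Liu2021, Def. 4.5 (2) (FJcycle.tex l. 1952)] -/
private theorem isCMCharacterMuAlg_objOne (σ₁ : E →+* ℂ) {μ : IdeleClassGroup E →ₜ* Circle}
    (hμ : IdeleClassGroup.IsConjugateSymplectic E μ) (hw : IdeleClassGroup.HasWeight E μ 1)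
    (obj : RestOne.ObjOne (AlgHom.id ℚ E) σ₁ hμ hw (Def45.Carriers.ofPolDR μ (Def45.PolDR σ₁ hμ (Def45.RMuForm σ₁ hμ)))) :
    Def45.IsCMCharacterMuAlg μ (RestOne.AμOne (AlgHom.id ℚ E) σ₁ hμ hw (Def45.Carriers.ofPolDR μ (Def45.PolDR σ₁ hμ (Def45.RMuForm σ₁ hμ))) obj)
      (RestOne.iOne (AlgHom.id ℚ E) σ₁ hμ hw (Def45.Carriers.ofPolDR μ (Def45.PolDR σ₁ hμ (Def45.RMuForm σ₁ hμ))) obj) :=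
  Def45.IsCMCharacterMuAlgHecke.isCMCharacterMuAlg (RestOne.datum (AlgHom.id ℚ E) σ₁ hμ hw (Def45.Carriers.ofPolDR μ (Def45.PolDR σ₁ hμ (Def45.RMuForm σ₁ hμ))) obj).isCMCharacter

end Helpers

section LabelSeparation

variable {F E : Type} [Field F] [NumberField F] [IsTotallyReal F] [Field E] [NumberField E] [Algebra F E]
  [IsTotallyComplex E] [Algebra.IsQuadraticExtension F E] [IsCMField E] [IsGalois ℚ E]
variable {P5 : PropC5Data F E} {isotropicAt : ℕ → Prop}

/-- **[Liu2021, Thm 4.18 proof l. 2258–2266] — the labels `μ′ ≠ ν` contribute nothing (GALOIS SEPARATION), generic form.**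
Data: a §4.2 datum `C` with `3 ≤ n`, oscillator carriers `U` (Def. 4.11), a Hecke datum `X` on `H¹_ét(A_∞ ⊗_E Ē, ℚ_ℓ)`, `ι : ℂ ≃+* ℚ_ℓ^{ac}`,
`E` a CM field Galois over `ℚ` with a pin `σ₁ : E → ℂ`, and for every label the cell's Def-4.5 carrier.  HYPOTHESES BY NAME: `h21` =
[Shimura1998, Thm 21.4] (Casselman; unused here except through `obj'`, see the `_objOne` corollary) and
`h415 : ∀ μ hμ hw obj, Thm415Pinned C U ℓ X ι μ hμ (A_μ obj) (i_μ obj)` = [Liu2021, Thm 4.15] pinned (row III-9′) at EVERY weight-one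
conjugate-symplectic label.  CLAIM: for a weight-one conjugate-symplectic `ν` with a CM datum `obj`, a label `μ′ ≠ ν` (weight one,
conjugate symplectic, with a CM datum `obj'`), a `μ′`-admissible `ε`, any `χ`, and a NON-ZERO `f ∈ Hom_{ℚ_ℓ^{ac}[𝔾]}(ι∘ω(μ′,ε,χ), ℚ_ℓ^{ac} ⊗ H¹_ét(A_∞))`,
there are `σ ∈ Γ_E`, `c ∈ ℚ_ℓ^{ac}` and a non-zero `x` on the line `ℚ_ℓ^{ac}·α_ν` with `σ·x = c·x` but `σ·f(w) ≠ c·f(w)` for some `w`.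
Proof: otherwise, at every place `v` good for `A_ν` and `A_{μ′}`, unramified for `ν^{alg}` and `μ′^{alg}`, `v ∤ ℓ` (almost all `v`), an
arithmetic Frobenius `σ_v` acts on `f(w₀) ≠ 0` both by `ι(ν^{alg}(ϖ_v))⁻¹` (negated claim + §2 for `A_ν`) and by `ι(μ′^{alg}(ϖ_v))⁻¹`
(`h415` at `μ′` + §2 for `A_{μ′}`, §1 for a non-zero vector of its line); so `ν^{alg}(ϖ_v) = μ′^{alg}(ϖ_v)` for almost all `v`,
`ν^{alg} = μ′^{alg}` (Cassels–Fröhlich VII Prop. 4.1, tree `HeckeCharacter.ext_of_eventually_valueAtUniformizer_eq`), `ν = μ′`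
(`toHeckeCharacter_injective`) — contradiction.
[cite: Liu2021, Thm 4.18 proof (FJcycle.tex l. 2258–2266); Thm 4.15 (l. 2177–2182); Def. 4.5 (2) (l. 1952)]
[cite: CasselsFrohlichANT1967, Ch. VII §4 Prop. 4.1] [cite: SerreTate1968, §4 Thm. 5 (i) and §7 Thm. 10–11] -/
theorem galoisLabelSeparation_of_thm415Pinned (C : Sec42Data P5 isotropicAt) (hn : 3 ≤ C.n) (U : UniformOmega C)
    (σ₁ : E →+* ℂ) (ℓ : ℕ) [Fact ℓ.Prime] (X : C.EtaleHeckeDatum ℓ) (ι : ℂ ≃+* AlgebraicClosure ℚ_[ℓ])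
    (h415 : ∀ (μ : IdeleClassGroup E →ₜ* Circle) (hμ : IdeleClassGroup.IsConjugateSymplectic E μ)
      (hw : IdeleClassGroup.HasWeight E μ 1) (obj : RestOne.ObjOne (AlgHom.id ℚ E) σ₁ hμ hw (Def45.Carriers.ofPolDR μ (Def45.PolDR σ₁ hμ (Def45.RMuForm σ₁ hμ)))),
      Thm415Pinned C U ℓ X ι μ hμ (RestOne.AμOne (AlgHom.id ℚ E) σ₁ hμ hw (Def45.Carriers.ofPolDR μ (Def45.PolDR σ₁ hμ (Def45.RMuForm σ₁ hμ))) obj)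
        (RestOne.iOne (AlgHom.id ℚ E) σ₁ hμ hw (Def45.Carriers.ofPolDR μ (Def45.PolDR σ₁ hμ (Def45.RMuForm σ₁ hμ))) obj))
    {ν : IdeleClassGroup E →ₜ* Circle} (hν : IdeleClassGroup.IsConjugateSymplectic E ν)
    (hwν : IdeleClassGroup.HasWeight E ν 1) (obj : RestOne.ObjOne (AlgHom.id ℚ E) σ₁ hν hwν (Def45.Carriers.ofPolDR ν (Def45.PolDR σ₁ hν (Def45.RMuForm σ₁ hν))))
    {μ' : IdeleClassGroup E →ₜ* Circle} (hμ' : IdeleClassGroup.IsConjugateSymplectic E μ')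
    (hw' : IdeleClassGroup.HasWeight E μ' 1) (obj' : RestOne.ObjOne (AlgHom.id ℚ E) σ₁ hμ' hw' (Def45.Carriers.ofPolDR μ' (Def45.PolDR σ₁ hμ' (Def45.RMuForm σ₁ hμ'))))
    (ε : U.Eps) (hε : ∃ e : E, IsAdmissibleElement E hμ'.cmType.1 e ∧ U.epsOf e = ε) (χ : U.Chi) (hne : μ' ≠ ν)
    {f : U.omega μ' hμ' ε χ →ₛₗ[(ι : ℂ →+* AlgebraicClosure ℚ_[ℓ])] AlgebraicClosure ℚ_[ℓ] ⊗[ℚ_[ℓ]] C.etaleH1Tower ℓ}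
    (hf : f ∈ X.omegaHom ι (U.rho μ' hμ' ε χ)) (hf0 : f ≠ 0) :
    ∃ (σ : Field.absoluteGaloisGroup E) (c : AlgebraicClosure ℚ_[ℓ]),
      (∃ x ∈ cmEigenline ℓ (RestOne.AμOne (AlgHom.id ℚ E) σ₁ hν hwν (Def45.Carriers.ofPolDR ν (Def45.PolDR σ₁ hν (Def45.RMuForm σ₁ hν))) obj) (IdeleClassGroup.muAlgValueField E ν)
          (RestOne.iOne (AlgHom.id ℚ E) σ₁ hν hwν (Def45.Carriers.ofPolDR ν (Def45.PolDR σ₁ hν (Def45.RMuForm σ₁ hν))) obj) ι,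
        x ≠ 0 ∧ galoisH1Bar ℓ (RestOne.AμOne (AlgHom.id ℚ E) σ₁ hν hwν (Def45.Carriers.ofPolDR ν (Def45.PolDR σ₁ hν (Def45.RMuForm σ₁ hν))) obj) σ x = c • x) ∧
      ∃ w : U.omega μ' hμ' ε χ, (C.towerRep ℓ σ).baseChange (AlgebraicClosure ℚ_[ℓ]) (f w) ≠ c • f w := by
  classical
  -- abbreviations for the two CM pairs
  set Aν := RestOne.AμOne (AlgHom.id ℚ E) σ₁ hν hwν (Def45.Carriers.ofPolDR ν (Def45.PolDR σ₁ hν (Def45.RMuForm σ₁ hν))) obj with hAν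
  set iν := RestOne.iOne (AlgHom.id ℚ E) σ₁ hν hwν (Def45.Carriers.ofPolDR ν (Def45.PolDR σ₁ hν (Def45.RMuForm σ₁ hν))) obj with hiν
  set Aμ := RestOne.AμOne (AlgHom.id ℚ E) σ₁ hμ' hw' (Def45.Carriers.ofPolDR μ' (Def45.PolDR σ₁ hμ' (Def45.RMuForm σ₁ hμ'))) obj' with hAμ
  set iμ := RestOne.iOne (AlgHom.id ℚ E) σ₁ hμ' hw' (Def45.Carriers.ofPolDR μ' (Def45.PolDR σ₁ hμ' (Def45.RMuForm σ₁ hμ'))) obj' with hiμ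
  by_contra hcon
  -- the negated claim: every `σ` acts on `f` by its eigenvalue on the `ν`-line
  have hall : ∀ (σ : Field.absoluteGaloisGroup E) (c : AlgebraicClosure ℚ_[ℓ]),
      (∃ x ∈ cmEigenline ℓ Aν (IdeleClassGroup.muAlgValueField E ν) iν ι, x ≠ 0 ∧ galoisH1Bar ℓ Aν σ x = c • x) →
        ∀ w, (C.towerRep ℓ σ).baseChange (AlgebraicClosure ℚ_[ℓ]) (f w) = c • f w := by
    intro σ c hx w
    by_contra hw
    exact hcon ⟨σ, c, hx, w, hw⟩
  -- non-zero vectors on the two lines (§1) and a vector not killed by `f`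
  haveI : NumberField (IdeleClassGroup.muAlgValueField E ν) := hν.numberField_muAlgValueField
  haveI : NumberField (IdeleClassGroup.muAlgValueField E μ') := hμ'.numberField_muAlgValueField
  obtain ⟨xν, hxν, hxν0⟩ := exists_ne_zero_mem_cmEigenline ℓ Aν (IdeleClassGroup.muAlgValueField E ν) iν
    (RestOne.hdimOne (AlgHom.id ℚ E) σ₁ hν hwν (Def45.Carriers.ofPolDR ν (Def45.PolDR σ₁ hν (Def45.RMuForm σ₁ hν))) obj) ι
  obtain ⟨xμ, hxμ, hxμ0⟩ := exists_ne_zero_mem_cmEigenline ℓ Aμ (IdeleClassGroup.muAlgValueField E μ') iμ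
    (RestOne.hdimOne (AlgHom.id ℚ E) σ₁ hμ' hw' (Def45.Carriers.ofPolDR μ' (Def45.PolDR σ₁ hμ' (Def45.RMuForm σ₁ hμ'))) obj') ι
  obtain ⟨w₀, hw₀⟩ : ∃ w, f w ≠ 0 := by
    by_contra h
    exact hf0 (LinearMap.ext fun w => not_not.1 (not_exists.1 h w))
  -- the Frobenius forms of [Def 4.5 (2)] for both pairs
  have hFν : Def45.IsCMCharacterMuAlg ν Aν iν := isCMCharacterMuAlg_objOne σ₁ hν hwν obj
  have hFμ : Def45.IsCMCharacterMuAlg μ' Aμ iμ := isCMCharacterMuAlg_objOne σ₁ hμ' hw' obj'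
  -- [Thm 4.15] at `μ′`
  have h415μ : Thm415Pinned C U ℓ X ι μ' hμ' Aμ iμ := h415 μ' hμ' hw' obj'
  -- the values of `ν^{alg}` and `μ′^{alg}` agree at the uniformisers of almost all places
  have hev : ∀ᶠ v : HeightOneSpectrum (𝓞 E) in Filter.cofinite,
      (IdeleClassGroup.muAlg E ν).valueAtUniformizer v = (IdeleClassGroup.muAlg E μ').valueAtUniformizer v := by
    have hgν := eventually_exists_isAbelianSchemeModel Aν
    have hgμ := eventually_exists_isAbelianSchemeModel Aμ
    have hurν : ∀ᶠ v in Filter.cofinite, (IdeleClassGroup.muAlg E ν).IsUnramifiedAt v :=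
      (IdeleClassGroup.muAlg E ν).finite_ramifiedPlaces_iff.1 (HeckeCharacter.finite_ramifiedPlaces_holds _)
    have hurμ : ∀ᶠ v in Filter.cofinite, (IdeleClassGroup.muAlg E μ').IsUnramifiedAt v :=
      (IdeleClassGroup.muAlg E μ').finite_ramifiedPlaces_iff.1 (HeckeCharacter.finite_ramifiedPlaces_holds _)
    have hℓ : ∀ᶠ v : HeightOneSpectrum (𝓞 E) in Filter.cofinite, (ℓ : 𝓞 E) ∉ v.asIdeal := by
      rw [Filter.eventually_cofinite]
      simpa only [not_not] using finite_setOf_natCast_mem_asIdeal (E := E) ℓ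
    filter_upwards [hgν, hgμ, hurν, hurμ, hℓ] with v hvν hvμ huν huμ hvℓ
    -- an arithmetic Frobenius at a prime above `v`
    obtain ⟨𝔓, h𝔓⟩ := v.primesAbove_nonempty
    obtain ⟨σ, hσ⟩ := HeightOneSpectrum.exists_isArithFrobAt_of_mem_primesAbove_holds h𝔓
    -- its eigenvalues on the two lines (§2)
    have hcν := galoisH1Bar_eq_smul_of_isCMCharacterMuAlg ℓ hFν ι hvν huν hvℓ h𝔓 hσ hxν
    have hcμ := galoisH1Bar_eq_smul_of_isCMCharacterMuAlg ℓ hFμ ι hvμ huμ hvℓ h𝔓 hσ hxμ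
    -- both act on `f w₀`
    have e1 := hall σ _ ⟨xν, hxν, hxν0, hcν⟩ w₀
    have e2 := h415μ.apply hn hw' ε hε χ σ _ ⟨xμ, hxμ, hxμ0, hcμ⟩ hf w₀
    rw [e1] at e2
    have e3 := smul_left_injective (AlgebraicClosure ℚ_[ℓ]) hw₀ e2
    have e4 : ι ((IdeleClassGroup.muAlg E ν).valueAtUniformizer v) = ι ((IdeleClassGroup.muAlg E μ').valueAtUniformizer v) :=
      inv_injective e3
    exact ι.injective e4
  -- hence `ν^{alg} = μ′^{alg}` and `ν = μ′`
  have halg : IdeleClassGroup.muAlg E ν = IdeleClassGroup.muAlg E μ' :=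
    HeckeCharacter.ext_of_eventually_valueAtUniformizer_eq hev
  have heq : ν = μ' := by
    apply IdeleClassGroup.toHeckeCharacter_injective (K := E)
    have := congrArg (· * normSqrtCharacter E) halg
    simpa only [IdeleClassGroup.muAlg_mul_normSqrtCharacter] using this
  exact hne heq.symm

/-- **The same, with the CM datum of `μ′` SUPPLIED by Casselman's theorem** (`h21` = [Shimura1998, Thm 21.4], the headline binder:
`𝒜(μ′) ≠ ∅` is [Liu2021] Prop. 4.6 (1), tree `Def45.nonempty_cmDatum_polDR_rMuForm_of_casselman`) — the exact shape consumed by the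
skeleton's face `StubGaloisLabelSeparation` (quantified over `obj` for `ν` only).
[cite: Liu2021, Thm 4.18 proof (FJcycle.tex l. 2258–2266); Prop. 4.6 (1) (l. 1969)] [cite: Shimura1998, §21.4 Thm. 21.4] -/
theorem galoisLabelSeparation_of_thm415Pinned_of_casselman (C : Sec42Data P5 isotropicAt) (hn : 3 ≤ C.n) (U : UniformOmega C)
    (σ₁ : E →+* ℂ) (ℓ : ℕ) [Fact ℓ.Prime] (X : C.EtaleHeckeDatum ℓ) (ι : ℂ ≃+* AlgebraicClosure ℚ_[ℓ])
    (h21 : shimura1998_thm21_4_casselman)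
    (h415 : ∀ (μ : IdeleClassGroup E →ₜ* Circle) (hμ : IdeleClassGroup.IsConjugateSymplectic E μ)
      (hw : IdeleClassGroup.HasWeight E μ 1) (obj : RestOne.ObjOne (AlgHom.id ℚ E) σ₁ hμ hw (Def45.Carriers.ofPolDR μ (Def45.PolDR σ₁ hμ (Def45.RMuForm σ₁ hμ)))),
      Thm415Pinned C U ℓ X ι μ hμ (RestOne.AμOne (AlgHom.id ℚ E) σ₁ hμ hw (Def45.Carriers.ofPolDR μ (Def45.PolDR σ₁ hμ (Def45.RMuForm σ₁ hμ))) obj)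
        (RestOne.iOne (AlgHom.id ℚ E) σ₁ hμ hw (Def45.Carriers.ofPolDR μ (Def45.PolDR σ₁ hμ (Def45.RMuForm σ₁ hμ))) obj))
    {ν : IdeleClassGroup E →ₜ* Circle} (hν : IdeleClassGroup.IsConjugateSymplectic E ν)
    (hwν : IdeleClassGroup.HasWeight E ν 1) (obj : RestOne.ObjOne (AlgHom.id ℚ E) σ₁ hν hwν (Def45.Carriers.ofPolDR ν (Def45.PolDR σ₁ hν (Def45.RMuForm σ₁ hν))))
    {μ' : IdeleClassGroup E →ₜ* Circle} (hμ' : IdeleClassGroup.IsConjugateSymplectic E μ')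
    (hw' : IdeleClassGroup.HasWeight E μ' 1)
    (ε : U.Eps) (hε : ∃ e : E, IsAdmissibleElement E hμ'.cmType.1 e ∧ U.epsOf e = ε) (χ : U.Chi) (hne : μ' ≠ ν)
    {f : U.omega μ' hμ' ε χ →ₛₗ[(ι : ℂ →+* AlgebraicClosure ℚ_[ℓ])] AlgebraicClosure ℚ_[ℓ] ⊗[ℚ_[ℓ]] C.etaleH1Tower ℓ}
    (hf : f ∈ X.omegaHom ι (U.rho μ' hμ' ε χ)) (hf0 : f ≠ 0) :
    ∃ (σ : Field.absoluteGaloisGroup E) (c : AlgebraicClosure ℚ_[ℓ]),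
      (∃ x ∈ cmEigenline ℓ (RestOne.AμOne (AlgHom.id ℚ E) σ₁ hν hwν (Def45.Carriers.ofPolDR ν (Def45.PolDR σ₁ hν (Def45.RMuForm σ₁ hν))) obj) (IdeleClassGroup.muAlgValueField E ν)
          (RestOne.iOne (AlgHom.id ℚ E) σ₁ hν hwν (Def45.Carriers.ofPolDR ν (Def45.PolDR σ₁ hν (Def45.RMuForm σ₁ hν))) obj) ι,
        x ≠ 0 ∧ galoisH1Bar ℓ (RestOne.AμOne (AlgHom.id ℚ E) σ₁ hν hwν (Def45.Carriers.ofPolDR ν (Def45.PolDR σ₁ hν (Def45.RMuForm σ₁ hν))) obj) σ x = c • x) ∧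
      ∃ w : U.omega μ' hμ' ε χ, (C.towerRep ℓ σ).baseChange (AlgebraicClosure ℚ_[ℓ]) (f w) ≠ c • f w := by
  obtain ⟨obj'⟩ := (RestOne.nonempty_objOne_iff (AlgHom.id ℚ E) σ₁ hμ' hw' (Def45.Carriers.ofPolDR μ' (Def45.PolDR σ₁ hμ' (Def45.RMuForm σ₁ hμ')))).2
    (Def45.nonempty_cmDatum_polDR_rMuForm_of_casselman σ₁ hμ' hw' h21)
  exact galoisLabelSeparation_of_thm415Pinned C hn U σ₁ ℓ X ι h415 hν hwν obj hμ' hw' obj' ε hε χ hne hf hf0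

end LabelSeparation

end Literature.NumberTheory.Automorphic.Liu2021.AppendixC

end
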